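import Mathlib.LinearAlgebra.Matrix.PosDef
import Mathlib.LinearAlgebra.Matrix.Hermitian
import Mathlib.LinearAlgebra.UnitaryGroup
import Mathlib.RingTheory.RootsOfUnity.Complex
import Mathlib.Analysis.SpecialFunctions.Pow.Real
import HarnessLib

/-!
# Quantum marginals of bipartite density operators: partial traces, spectra, and the
# Bürgisser–Christandl–Ikenmeyer density operator with uniform marginals (BCI Prop. 2)

This file supplies the quantum-information side of the proof of Bürgisser–Christandl–Ikenmeyer,
*Nonvanishing of Kronecker coefficients for rectangular shapes*, Adv. Math. 227 (2011), Thm. 1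
(tree: `Literature.Barriers.ValiantsHypothesis.BCI2011_thm1`), namely

* the **partial traces** `traceRight ρ = tr_B ρ`, `traceLeft ρ = tr_A ρ` of an operator `ρ` on
  `ℂ^A ⊗ ℂ^B` (matrices indexed by `m × n`; BCI §2.2: "`tr_B` is the linear map uniquely
  characterized by `tr(R tr_B(ρ_{AB})) = tr(ρ_{AB} (R ⊗ Id))`"), density operators
  (`IsDensity`: positive semidefinite of trace `1`, BCI §2.2) and the relation
  "`ρ` has spectrum `r`" rendered as a unitary diagonalisation `ρ = U diag(r) U†`
  (`HasSpectrum`; BCI §2.2: "By the spectrum `spec ρ` of `ρ` we will understand the vector of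
  eigenvalues of `ρ`");
* **BCI Prop. 2** (§5.1), PROVED (`exists_isDensity_hasSpectrum_uniform_marginals`): "For any
  decreasing probability distribution `r` on `[d²]` there exists a density operator
  `ρ_{AB} ∈ 𝒮(ℋ_A ⊗ ℋ_B)` with spectrum `r` such that `tr_A(ρ_{AB}) = tr_B(ρ_{AB}) = u_d`, where
  `ℋ_A ≃ ℋ_B ≃ ℂ^d`" (`u_d` the uniform distribution, i.e. the marginals are `d⁻¹ · 1`). As in
  the printed proof (Lemmas 4, 5): `ρ_{AB} = ∑_{ij} r_{ij} |ψ_{ij}⟩⟨ψ_{ij}|` for the orthonormal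
  basis `|ψ_{ij}⟩ = (id ⊗ X^i Z^j)|ψ_{00}⟩`, `|ψ_{00}⟩ = d^{-1/2} ∑_ℓ |ℓ⟩|ℓ⟩`, of maximally entangled
  vectors built from the discrete Weyl operators `X|i⟩ = |i+1⟩`, `Z|i⟩ = ω^i |i⟩` (`ω` a primitive
  `d`-th root of unity); here the basis is the unitary matrix `bellUnitary d`
  (`(a,b) ↦ (i,j)`-entry `d^{-1/2} [b = a + i] ω^{ja}`) and `ρ = U diag(r) U†`
  (`bciDensity d r`); the distribution `r` is indexed by `[d] × [d]` directly ("assuming some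
  bijection `[d²] ≃ [d]²`", BCI proof of Prop. 2), and monotonicity of `r` is not needed;
* these are the data of **Klyachko's theorem on rational spectral triples**
  (Christandl–Harrow–Mitchison, Comm. Math. Phys. 270 (2007), Thm. 2.3: "For a density operator
  `ρ^{AB}` with the rational spectral triple `(r^A, r^B, r^{AB})` there is an integer `m > 0` such
  that `g_{m r^A, m r^B, m r^{AB}} ≠ 0`"), from which BCI Thm. 1(2) follows (§5.1); that theorem is
  NOT vendored here (no named fact is introduced): the reduction
  `Literature.Barriers.ValiantsHypothesis.BCI2011_thm1_of_klyachko` takes its statement, written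
  with `IsDensity`, `HasSpectrum`, `traceLeft`, `traceRight`, as an explicit hypothesis.

Not here: the estimation theorem of Keyl–Werner, the spectral characterisation of the Kronecker
polytope and its rationality (CHM Thms. 2.2, 2.3, 3.2; BCI §2.1, §2.3–2.4).

## References

* P. Bürgisser, M. Christandl, C. Ikenmeyer, Adv. Math. 227 (2011) 2082–2091 = arXiv:0910.4512,
  §2.2, §5.1 (Prop. 2, Lemmas 4, 5). [BurgisserChristandlIkenmeyer2011]
* M. Christandl, A. W. Harrow, G. Mitchison, Comm. Math. Phys. 270 (2007) 575–585 =
  arXiv:quant-ph/0511029, Thm. 2.3 (Klyachko's theorem), Thm. 2.2, §6. [ChristandlHarrowMitchison2007]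

## Mathlib

Used: `Matrix.unitaryGroup` (`Matrix.mem_unitaryGroup_iff`), `Matrix.PosSemidef`
(`PosSemidef.diagonal`, `PosSemidef.mul_mul_conjTranspose_same`), `Matrix.trace_mul_cycle`,
`Complex.isPrimitiveRoot_exp`, `IsPrimitiveRoot.pow_eq_one_iff_dvd`, `geom_sum_eq`. Mathlib has
no partial trace of matrices on a product index type and no density operators.
-/

noncomputable section

open Matrix Finset
open scoped BigOperators ComplexOrder

namespace Literature.Computability.QuantumComplexity

/-! ### Partial traces, density operators, spectra -/

section PartialTrace

variable {m n R : Type*} [Fintype m] [Fintype n] [NonUnitalNonAssocSemiring R]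

/-- The partial trace over the second factor, `tr_B : L(ℋ_A ⊗ ℋ_B) → L(ℋ_A)`,
`(tr_B ρ)_{a a'} = ∑_b ρ_{(a,b),(a',b)}`. [cite: BurgisserChristandlIkenmeyer2011, §2.2] -/
def traceRight (ρ : Matrix (m × n) (m × n) R) : Matrix m m R :=
  Matrix.of fun a a' => ∑ b, ρ (a, b) (a', b)

/-- The partial trace over the first factor, `tr_A : L(ℋ_A ⊗ ℋ_B) → L(ℋ_B)`,
`(tr_A ρ)_{b b'} = ∑_a ρ_{(a,b),(a,b')}`. [cite: BurgisserChristandlIkenmeyer2011, §2.2] -/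
def traceLeft (ρ : Matrix (m × n) (m × n) R) : Matrix n n R :=
  Matrix.of fun b b' => ∑ a, ρ (a, b) (a, b')

omit [Fintype m] in
/-- Entries of `tr_B`. [folklore] -/
@[simp] theorem traceRight_apply (ρ : Matrix (m × n) (m × n) R) (a a' : m) :
    traceRight ρ a a' = ∑ b, ρ (a, b) (a', b) := rfl

omit [Fintype n] in
/-- Entries of `tr_A`. [folklore] -/
@[simp] theorem traceLeft_apply (ρ : Matrix (m × n) (m × n) R) (b b' : n) :
    traceLeft ρ b b' = ∑ a, ρ (a, b) (a, b') := rfl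

/-- `tr (tr_B ρ) = tr ρ`. [cite: BurgisserChristandlIkenmeyer2011, §2.2] -/
theorem trace_traceRight (ρ : Matrix (m × n) (m × n) R) : (traceRight ρ).trace = ρ.trace := by
  simp only [Matrix.trace, Matrix.diag, traceRight_apply]
  rw [← Finset.univ_product_univ, Finset.sum_product]

/-- `tr (tr_A ρ) = tr ρ`. [cite: BurgisserChristandlIkenmeyer2011, §2.2] -/
theorem trace_traceLeft (ρ : Matrix (m × n) (m × n) R) : (traceLeft ρ).trace = ρ.trace := by
  simp only [Matrix.trace, Matrix.diag, traceLeft_apply]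
  rw [← Finset.univ_product_univ, Finset.sum_product, Finset.sum_comm]

/-- The defining property of `tr_B`: `tr (S · tr_B ρ) = tr ((S ⊗ 1) ρ)` for every `S` on the first
factor, with `(S ⊗ 1)_{(a,b),(a',b')} = S_{a a'} [b = b']` written out.
[cite: BurgisserChristandlIkenmeyer2011, §2.2] -/
theorem trace_mul_traceRight [DecidableEq n] (S : Matrix m m R) (ρ : Matrix (m × n) (m × n) R) :
    (S * traceRight ρ).trace =
      ((Matrix.of fun p q : m × n => if p.2 = q.2 then S p.1 q.1 else 0) * ρ).trace := by
  simp only [Matrix.trace, Matrix.diag, Matrix.mul_apply, traceRight_apply, Matrix.of_apply,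
    Finset.mul_sum, Fintype.sum_prod_type, ite_mul, zero_mul, Finset.sum_ite_eq, Finset.mem_univ,
    if_true]
  exact Finset.sum_congr rfl fun a _ => Finset.sum_comm

end PartialTrace

section Density

variable {m : Type*} [Fintype m]

/-- A density operator: positive semidefinite of trace one (`𝒮(ℋ) = {ρ ≥ 0, tr ρ = 1}`).
[cite: BurgisserChristandlIkenmeyer2011, §2.2] -/
def IsDensity (ρ : Matrix m m ℂ) : Prop :=
  ρ.PosSemidef ∧ ρ.trace = 1

/-- "`ρ` has spectrum `r`": `ρ = U diag(r) U†` for a unitary `U` (so `r`, in any order, is the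
vector of eigenvalues of the Hermitian operator `ρ`; BCI sort it decreasingly, which is a
condition on `r` stated separately where needed). [cite: BurgisserChristandlIkenmeyer2011, §2.2] -/
def HasSpectrum [DecidableEq m] (ρ : Matrix m m ℂ) (r : m → ℝ) : Prop :=
  ∃ U ∈ Matrix.unitaryGroup m ℂ, ρ = U * Matrix.diagonal (fun i => ((r i : ℝ) : ℂ)) * star U

/-- The maximally mixed state `d⁻¹ · 1` has the uniform spectrum. [folklore] -/
theorem hasSpectrum_uniform [DecidableEq m] (c : ℝ) :
    HasSpectrum ((c : ℂ) • (1 : Matrix m m ℂ)) (fun _ => c) := by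
  refine ⟨1, Submonoid.one_mem _, ?_⟩
  rw [star_one, one_mul, mul_one]
  ext i j
  by_cases h : i = j
  · subst h; simp
  · simp [h]

end Density

/-! ### Roots of unity -/

section Root

variable (d : ℕ) [NeZero d]

/-- The primitive `d`-th root of unity `ω = exp(2πi/d)` of the discrete Weyl operator `Z`.
[cite: BurgisserChristandlIkenmeyer2011, §5.1] -/
def bellRoot : ℂ :=
  Complex.exp (2 * Real.pi * Complex.I / d)

/-- `ω` is a primitive `d`-th root of unity (Mathlib `Complex.isPrimitiveRoot_exp`). [folklore] -/
theorem isPrimitiveRoot_bellRoot : IsPrimitiveRoot (bellRoot d) d :=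
  Complex.isPrimitiveRoot_exp d (NeZero.ne d)

/-- `ω^d = 1`. [folklore] -/
theorem bellRoot_pow_self : bellRoot d ^ d = 1 :=
  (isPrimitiveRoot_bellRoot d).pow_eq_one

/-- `ω^t = 1 ↔ d ∣ t`. [folklore] -/
theorem bellRoot_pow_eq_one_iff (t : ℕ) : bellRoot d ^ t = 1 ↔ d ∣ t :=
  (isPrimitiveRoot_bellRoot d).pow_eq_one_iff_dvd t

/-- `|ω| = 1`. [folklore] -/
theorem norm_bellRoot : ‖bellRoot d‖ = 1 := by
  have h := congrArg norm (bellRoot_pow_self d)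
  rw [norm_pow, norm_one] at h
  exact (pow_eq_one_iff_of_nonneg (norm_nonneg _) (NeZero.ne d)).mp h

/-- `ω · ω̄ = 1`. [folklore] -/
theorem bellRoot_mul_star : bellRoot d * star (bellRoot d) = 1 := by
  rw [Complex.star_def, Complex.mul_conj, Complex.normSq_eq_norm_sq, norm_bellRoot d]
  simp

/-- `ω^t · conj(ω^t) = 1`. [folklore] -/
theorem bellRoot_pow_mul_star_pow (t : ℕ) : bellRoot d ^ t * star (bellRoot d ^ t) = 1 := by
  rw [star_pow, ← mul_pow, bellRoot_mul_star, one_pow]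

/-- `ω̄ = ω^{d-1}`. [folklore] -/
theorem star_bellRoot : star (bellRoot d) = bellRoot d ^ (d - 1) := by
  have h1 : bellRoot d * star (bellRoot d) = bellRoot d * bellRoot d ^ (d - 1) := by
    rw [bellRoot_mul_star, ← pow_succ', Nat.sub_add_cancel (NeZero.one_le), bellRoot_pow_self]
  have hne : bellRoot d ≠ 0 := fun h0 => by simpa [h0] using bellRoot_mul_star d
  exact mul_left_cancel₀ hne h1

omit [NeZero d] in
/-- A `d`-th root of unity other than `1` has vanishing geometric sum `∑_{j<d} ζ^j = 0`.
[folklore] -/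
theorem sum_pow_eq_zero_of_pow_eq_one {ζ : ℂ} (hd : ζ ^ d = 1) (h1 : ζ ≠ 1) :
    ∑ j : Fin d, ζ ^ (j : ℕ) = 0 := by
  rw [Fin.sum_univ_eq_sum_range (fun j => ζ ^ j) d, geom_sum_eq h1, hd, sub_self, zero_div]

/-- Orthogonality of characters of `ℤ/d`: `∑_j ω^{tj} = d` if `d ∣ t` and `0` otherwise.
[folklore] -/
theorem sum_bellRoot_pow_mul (t : ℕ) :
    ∑ j : Fin d, bellRoot d ^ (t * (j : ℕ)) = if d ∣ t then (d : ℂ) else 0 := by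
  simp_rw [pow_mul]
  split_ifs with h
  · rw [(bellRoot_pow_eq_one_iff d t).mpr h]
    simp
  · exact sum_pow_eq_zero_of_pow_eq_one d (by rw [← pow_mul, mul_comm, pow_mul, bellRoot_pow_self,
      one_pow]) (fun h1 => h ((bellRoot_pow_eq_one_iff d t).mp h1))

/-- For `a, a' < d`: `d ∣ a + (d-1) a'` iff `a = a'` (`(d-1) a' ≡ -a' mod d`). [folklore] -/
theorem dvd_add_pred_mul_iff {a a' : ℕ} (ha : a < d) (ha' : a' < d) :
    d ∣ a + (d - 1) * a' ↔ a = a' := by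
  have hd1 : 1 ≤ d := NeZero.one_le
  constructor
  · intro h
    have h' : (d : ℤ) ∣ (a : ℤ) - a' := by
      have h2 : ((a + (d - 1) * a' : ℕ) : ℤ) = ((a : ℤ) - a') + d * a' := by
        push_cast [Nat.cast_sub hd1]
        ring
      have h3 : (d : ℤ) ∣ ((a : ℤ) - a') + d * a' := h2 ▸ Int.natCast_dvd_natCast.mpr h
      simpa using (Int.dvd_add_left (Dvd.intro _ rfl)).mp h3
    have habs : |(a : ℤ) - a'| < d := by
      rw [abs_lt]; constructor <;> omega
    have := Int.eq_zero_of_abs_lt_dvd h' habs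
    omega
  · rintro rfl
    rw [← Nat.succ_pred_eq_of_pos hd1]
    simp only [Nat.succ_sub_one, Nat.succ_eq_add_one]
    exact ⟨a, by ring⟩

/-- The phase `ω^{ja}` of the Bell vector `ψ_{ij}` at position `a`.
[cite: BurgisserChristandlIkenmeyer2011, §5.1] -/
def bellPhase (j a : Fin d) : ℂ :=
  bellRoot d ^ ((j : ℕ) * (a : ℕ))

/-- `ω^{ja} conj(ω^{ja}) = 1`. [folklore] -/
theorem bellPhase_mul_star_self (j a : Fin d) : bellPhase d j a * star (bellPhase d j a) = 1 :=
  bellRoot_pow_mul_star_pow d _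

/-- **Trace orthogonality of the Weyl operators** (the computation in the proof of BCI Lemma 5):
`∑_j ω^{ja} conj(ω^{ja'}) = d [a = a']`. [cite: BurgisserChristandlIkenmeyer2011, Lemma 5] -/
theorem sum_bellPhase_mul_star (a a' : Fin d) :
    ∑ j : Fin d, bellPhase d j a * star (bellPhase d j a') = if a = a' then (d : ℂ) else 0 := by
  have key : ∀ j : Fin d, bellPhase d j a * star (bellPhase d j a') =
      bellRoot d ^ (((a : ℕ) + (d - 1) * (a' : ℕ)) * (j : ℕ)) := by
    intro j
    rw [bellPhase, bellPhase, star_pow, star_bellRoot, ← pow_mul, ← pow_add]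
    congr 1
    ring
  simp_rw [key]
  rw [sum_bellRoot_pow_mul]
  by_cases h : a = a'
  · rw [if_pos h, if_pos ((dvd_add_pred_mul_iff d a.2 a'.2).mpr (congrArg Fin.val h))]
  · rw [if_neg h, if_neg (fun h' => h (Fin.ext ((dvd_add_pred_mul_iff d a.2 a'.2).mp h')))]

end Root

/-! ### The Bell basis and BCI Prop. 2 -/

section Bell

variable (d : ℕ) [NeZero d]

/-- The normalisation `d^{-1/2}` of the maximally entangled vectors. [folklore] -/
def bellNorm : ℂ :=
  ((Real.sqrt d : ℝ) : ℂ)⁻¹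

omit [NeZero d] in
/-- `d^{-1/2}` is real: `conj(d^{-1/2}) = d^{-1/2}`. [folklore] -/
theorem star_bellNorm : star (bellNorm d) = bellNorm d := by
  rw [bellNorm, Complex.star_def, map_inv₀, Complex.conj_ofReal]

omit [NeZero d] in
/-- `d^{-1/2} · d^{-1/2} = d⁻¹`. [folklore] -/
theorem bellNorm_mul_self : bellNorm d * bellNorm d = (d : ℂ)⁻¹ := by
  rw [bellNorm, ← mul_inv, ← Complex.ofReal_mul, Real.mul_self_sqrt (Nat.cast_nonneg d),
    Complex.ofReal_natCast]

/-- `d^{-1/2} · d^{-1/2} · d = 1`. [folklore] -/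
theorem bellNorm_mul_self_mul_card : bellNorm d * bellNorm d * d = 1 := by
  rw [bellNorm_mul_self, inv_mul_cancel₀ (Nat.cast_ne_zero.mpr (NeZero.ne d))]

/-- **The Bell basis as a matrix**: the `((a,b),(i,j))` entry is the `(a,b)`-coordinate of
`|ψ_{ij}⟩ = (id ⊗ X^i Z^j)|ψ_{00}⟩ = d^{-1/2} ∑_a ω^{ja} |a⟩|a+i⟩`, i.e. `d^{-1/2} [b = a+i] ω^{ja}`
(addition in `ℤ/d`). Its columns are the `d²` maximally entangled vectors `|ψ_{ij}⟩` of BCI §5.1.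
[cite: BurgisserChristandlIkenmeyer2011, §5.1 (before Lemma 5)] -/
def bellUnitary : Matrix (Fin d × Fin d) (Fin d × Fin d) ℂ :=
  Matrix.of fun p q => if p.2 = p.1 + q.1 then bellNorm d * bellPhase d q.2 p.1 else 0

omit [NeZero d] in
/-- Entries of the Bell matrix. [folklore] -/
theorem bellUnitary_apply (a b i j : Fin d) :
    bellUnitary d (a, b) (i, j) = if b = a + i then bellNorm d * bellPhase d j a else 0 := rfl

omit [NeZero d] in
/-- Products of an entry of the Bell matrix with a conjugate entry in the same column.
[folklore] -/
theorem bellUnitary_mul_star (a b a' b' i j : Fin d) :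
    bellUnitary d (a, b) (i, j) * star (bellUnitary d (a', b') (i, j)) =
      if b = a + i ∧ b' = a' + i then
        bellNorm d * bellNorm d * (bellPhase d j a * star (bellPhase d j a')) else 0 := by
  rw [bellUnitary_apply, bellUnitary_apply]
  by_cases h1 : b = a + i
  · by_cases h2 : b' = a' + i
    · rw [if_pos h1, if_pos h2, if_pos ⟨h1, h2⟩, star_mul, star_bellNorm]
      ring
    · rw [if_neg h2, star_zero, mul_zero, if_neg (fun h : b = a + i ∧ b' = a' + i => h2 h.2)]
  · rw [if_neg h1, zero_mul, if_neg (fun h : b = a + i ∧ b' = a' + i => h1 h.1)]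

/-- **BCI Lemma 5: the vectors `|ψ_{ij}⟩` form an orthonormal basis**, i.e. the Bell matrix is
unitary (`U U† = 1`; the computation is the character orthogonality
`∑_j ω^{ja} conj(ω^{ja'}) = d [a = a']`). [cite: BurgisserChristandlIkenmeyer2011, Lemma 5] -/
theorem bellUnitary_mem_unitaryGroup : bellUnitary d ∈ Matrix.unitaryGroup (Fin d × Fin d) ℂ := by
  rw [Matrix.mem_unitaryGroup_iff]
  ext ⟨a, b⟩ ⟨a', b'⟩
  rw [Matrix.mul_apply, ← Finset.univ_product_univ, Finset.sum_product]
  simp only [Matrix.star_apply, bellUnitary_mul_star]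
  -- ∑_i ∑_j [b = a+i ∧ b' = a'+i] c² ω^{ja} conj(ω^{ja'})
  have inner : ∀ i : Fin d, (∑ j : Fin d, if b = a + i ∧ b' = a' + i then
      bellNorm d * bellNorm d * (bellPhase d j a * star (bellPhase d j a')) else 0) =
      if b = a + i ∧ b' = a' + i then
        bellNorm d * bellNorm d * (if a = a' then (d : ℂ) else 0) else 0 := by
    intro i
    by_cases h : b = a + i ∧ b' = a' + i
    · simp only [if_pos h]
      rw [← Finset.mul_sum, sum_bellPhase_mul_star]
    · simp only [if_neg h, Finset.sum_const_zero]
  simp_rw [inner]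
  by_cases haa : a = a'
  · subst haa
    simp only [if_true]
    by_cases hbb : b = b'
    · subst hbb
      have hba : b = a + (b - a) := by abel
      rw [Finset.sum_eq_single (b - a), if_pos ⟨hba, hba⟩, bellNorm_mul_self_mul_card,
        Matrix.one_apply_eq]
      · intro i _ hi
        exact if_neg (fun h : b = a + i ∧ b = a + i => hi (by rw [h.1]; abel))
      · exact fun h => absurd (Finset.mem_univ _) h
    · rw [Finset.sum_eq_zero (fun i _ => if_neg (fun h : b = a + i ∧ b' = a + i =>
        hbb (h.1.trans h.2.symm))), Matrix.one_apply_ne (fun h => hbb (Prod.ext_iff.mp h).2)]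
  · simp only [haa, if_false, mul_zero, ite_self, Finset.sum_const_zero]
    rw [Matrix.one_apply_ne (fun h => haa (Prod.ext_iff.mp h).1)]

variable {d}

/-- **The BCI density operator** `ρ_{AB} = ∑_{ij} r_{ij} |ψ_{ij}⟩⟨ψ_{ij}| = U diag(r) U†` with the
prescribed spectrum `r` (indexed by `[d] × [d]`, "assuming some bijection `[d²] ≃ [d]²`").
[cite: BurgisserChristandlIkenmeyer2011, Prop. 2 (proof)] -/
def bciDensity (r : Fin d × Fin d → ℝ) : Matrix (Fin d × Fin d) (Fin d × Fin d) ℂ :=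
  bellUnitary d * Matrix.diagonal (fun q => ((r q : ℝ) : ℂ)) * star (bellUnitary d)

omit [NeZero d] in
/-- Entries of `U diag(r) U†`: `ρ_{pq} = ∑_c U_{pc} r_c conj(U_{qc})`. [folklore] -/
theorem bciDensity_apply (r : Fin d × Fin d → ℝ) (p q : Fin d × Fin d) :
    bciDensity r p q = ∑ c, ((r c : ℝ) : ℂ) * (bellUnitary d p c * star (bellUnitary d q c)) := by
  rw [bciDensity, Matrix.mul_apply]
  refine Finset.sum_congr rfl fun c _ => ?_
  rw [Matrix.mul_diagonal, Matrix.star_apply]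
  ring

/-- `ρ_{AB}` has spectrum `r` (by construction, Lemma 5 giving unitarity).
[cite: BurgisserChristandlIkenmeyer2011, Prop. 2 (proof)] -/
theorem hasSpectrum_bciDensity (r : Fin d × Fin d → ℝ) : HasSpectrum (bciDensity r) r :=
  ⟨bellUnitary d, bellUnitary_mem_unitaryGroup d, rfl⟩

omit [NeZero d] in
/-- `ρ_{AB}` is positive semidefinite when `r ≥ 0`. [cite: BurgisserChristandlIkenmeyer2011, Prop. 2 (proof)] -/
theorem posSemidef_bciDensity {r : Fin d × Fin d → ℝ} (hr : ∀ q, 0 ≤ r q) :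
    (bciDensity r).PosSemidef := by
  have hD : (Matrix.diagonal fun q : Fin d × Fin d => ((r q : ℝ) : ℂ)).PosSemidef :=
    Matrix.PosSemidef.diagonal fun q => Complex.zero_le_real.mpr (hr q)
  have h := hD.mul_mul_conjTranspose_same (bellUnitary d)
  rwa [← Matrix.star_eq_conjTranspose] at h

/-- `tr ρ_{AB} = ∑ r`. [cite: BurgisserChristandlIkenmeyer2011, Prop. 2 (proof)] -/
theorem trace_bciDensity (r : Fin d × Fin d → ℝ) :
    (bciDensity r).trace = ∑ q, ((r q : ℝ) : ℂ) := by
  have hU := Matrix.mem_unitaryGroup_iff'.mp (bellUnitary_mem_unitaryGroup d)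
  rw [bciDensity, Matrix.trace_mul_cycle, hU, Matrix.one_mul, Matrix.trace_diagonal]

/-- **BCI Lemma 4 / proof of Prop. 2, right marginal**: `tr_B ρ_{AB} = (∑ r) d⁻¹ · 1`
(each `|ψ_{ij}⟩` has Schmidt coefficients `d^{-1/2}`, so `tr_B |ψ_{ij}⟩⟨ψ_{ij}| = u_d`).
[cite: BurgisserChristandlIkenmeyer2011, Prop. 2 (proof) and Lemma 4] -/
theorem traceRight_bciDensity (r : Fin d × Fin d → ℝ) :
    traceRight (bciDensity r) = ((∑ q, ((r q : ℝ) : ℂ)) * (d : ℂ)⁻¹) • (1 : Matrix (Fin d) (Fin d) ℂ) := by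
  ext a a'
  rw [traceRight_apply]
  simp_rw [bciDensity_apply]
  rw [Finset.sum_comm]
  -- for each c = (i,j): ∑_b [b = a+i ∧ b = a'+i] c² ω^{ja} conj(ω^{ja'}) = [a = a'] c²
  have inner : ∀ c : Fin d × Fin d, (∑ b : Fin d, ((r c : ℝ) : ℂ) *
      (bellUnitary d (a, b) c * star (bellUnitary d (a', b) c))) =
      ((r c : ℝ) : ℂ) * (if a = a' then bellNorm d * bellNorm d else 0) := by
    rintro ⟨i, j⟩
    rw [← Finset.mul_sum]
    congr 1
    simp_rw [bellUnitary_mul_star]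
    by_cases h : a = a'
    · subst h
      rw [if_pos rfl, Finset.sum_eq_single (a + i), if_pos ⟨rfl, rfl⟩, bellPhase_mul_star_self,
        mul_one]
      · intro b _ hb
        exact if_neg (fun h : b = a + i ∧ b = a + i => hb h.1)
      · exact fun h => absurd (Finset.mem_univ _) h
    · rw [if_neg h]
      exact Finset.sum_eq_zero fun b _ => if_neg fun hb : b = a + i ∧ b = a' + i =>
        h (add_right_cancel (hb.1.symm.trans hb.2))
  simp_rw [inner]
  rw [← Finset.sum_mul, Matrix.smul_apply, smul_eq_mul]
  by_cases h : a = a'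
  · subst h
    rw [if_pos rfl, Matrix.one_apply_eq, mul_one, bellNorm_mul_self]
  · rw [if_neg h, Matrix.one_apply_ne h, mul_zero, mul_zero]

/-- **Proof of Prop. 2, left marginal**: `tr_A ρ_{AB} = (∑ r) d⁻¹ · 1`.
[cite: BurgisserChristandlIkenmeyer2011, Prop. 2 (proof) and Lemma 4] -/
theorem traceLeft_bciDensity (r : Fin d × Fin d → ℝ) :
    traceLeft (bciDensity r) = ((∑ q, ((r q : ℝ) : ℂ)) * (d : ℂ)⁻¹) • (1 : Matrix (Fin d) (Fin d) ℂ) := by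
  ext b b'
  rw [traceLeft_apply]
  simp_rw [bciDensity_apply]
  rw [Finset.sum_comm]
  have inner : ∀ c : Fin d × Fin d, (∑ a : Fin d, ((r c : ℝ) : ℂ) *
      (bellUnitary d (a, b) c * star (bellUnitary d (a, b') c))) =
      ((r c : ℝ) : ℂ) * (if b = b' then bellNorm d * bellNorm d else 0) := by
    rintro ⟨i, j⟩
    rw [← Finset.mul_sum]
    congr 1
    simp_rw [bellUnitary_mul_star]
    by_cases h : b = b'
    · subst h
      have hbi : b = (b - i) + i := by abel
      rw [if_pos rfl, Finset.sum_eq_single (b - i), if_pos ⟨hbi, hbi⟩, bellPhase_mul_star_self,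
        mul_one]
      · intro a _ ha
        exact if_neg (fun h : b = a + i ∧ b = a + i => ha (by rw [h.1]; abel))
      · exact fun h => absurd (Finset.mem_univ _) h
    · rw [if_neg h]
      exact Finset.sum_eq_zero fun a _ => if_neg fun hb : b = a + i ∧ b' = a + i =>
        h (hb.1.trans hb.2.symm)
  simp_rw [inner]
  rw [← Finset.sum_mul, Matrix.smul_apply, smul_eq_mul]
  by_cases h : b = b'
  · subst h
    rw [if_pos rfl, Matrix.one_apply_eq, mul_one, bellNorm_mul_self]
  · rw [if_neg h, Matrix.one_apply_ne h, mul_zero, mul_zero]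

/-- **BCI Prop. 2.** "For any decreasing probability distribution `r` on `[d²]` there exists a
density operator `ρ_{AB} ∈ 𝒮(ℋ_A ⊗ ℋ_B)` with spectrum `r` such that
`tr_A(ρ_{AB}) = tr_B(ρ_{AB}) = u_d`, where `ℋ_A ≃ ℋ_B ≃ ℂ^d`." Here `r` is any probability vector on
`[d] × [d]` (monotonicity plays no role) and `u_d` is the maximally mixed state `d⁻¹ · 1`.
[cite: BurgisserChristandlIkenmeyer2011, Prop. 2] -/
theorem exists_isDensity_hasSpectrum_uniform_marginals {r : Fin d × Fin d → ℝ}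
    (hr : ∀ q, 0 ≤ r q) (hr1 : ∑ q, r q = 1) :
    ∃ ρ : Matrix (Fin d × Fin d) (Fin d × Fin d) ℂ, IsDensity ρ ∧ HasSpectrum ρ r ∧
      traceRight ρ = (d : ℂ)⁻¹ • (1 : Matrix (Fin d) (Fin d) ℂ) ∧
      traceLeft ρ = (d : ℂ)⁻¹ • (1 : Matrix (Fin d) (Fin d) ℂ) := by
  have hsum : ∑ q, ((r q : ℝ) : ℂ) = 1 := by
    rw [← Complex.ofReal_sum, hr1, Complex.ofReal_one]
  refine ⟨bciDensity r, ⟨posSemidef_bciDensity hr, by rw [trace_bciDensity, hsum]⟩,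
    hasSpectrum_bciDensity r, ?_, ?_⟩
  · rw [traceRight_bciDensity, hsum, one_mul]
  · rw [traceLeft_bciDensity, hsum, one_mul]

end Bell


end Literature.Computability.QuantumComplexity
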